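import Literature.Barriers.RiemannHypothesis.LiouvilleSignConjectures
import Literature.NumberTheory.LFunctions.LiouvilleOneSidedRH
import Literature.NumberTheory.LFunctions.LiouvilleOneSidedZeros
import HarnessLib

/-!
# The hypothesis `LiouvilleSumEventuallyOneSigned` of Pólya's criterion: one disjunct refuted, simple zeros under the other (proofs for `LiouvilleSignConjectures.lean`)

Sibling of `Literature/Barriers/RiemannHypothesis/LiouvilleSignConjectures.lean` (the barrier) and
of `LiouvilleSignConjecturesProofs.lean` (which discharges Pólya's criterion,
`Polya1919_criterion_holds : LiouvilleSumEventuallyOneSigned → RiemannHypothesis`, and refutes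
`PolyaConjecture`). The barrier vendors, as the named Prop
`Literature.Barriers.RiemannHypothesis.LiouvilleSumEventuallyOneSigned`, the HYPOTHESIS of Pólya's
1919 remark — "`L(n)` does not change sign for sufficiently large `n`", i.e. eventually `L(n) ≤ 0`
or eventually `L(n) ≥ 0` (Borwein–Ferguson–Mossinghoff 2008, §1, p. 1681). It is not a result and
has no `_holds`: the same source prints its refutation ("In 1958, Haselgrove proved that both
`L(n)` and `T(n)` change sign", §1, p. 1683; vendored as `Haselgrove1958_signChanges`, whence the
barrier's `not_eventuallyOneSigned_of_haselgrove`). This file records, unconditionally and with the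
three standard axioms only, what the tree now proves about it:

* `liouvilleSumEventuallyOneSigned_iff_eventually_nonpos` — `L(n) < 0` for arbitrarily large `n`
  and hence `L(n)` is not eventually `≥ 0`: these are the tree's
  `Literature.NumberTheory.LFunctions.frequently_liouvilleSum_natCast_neg` and
  `Literature.NumberTheory.LFunctions.not_eventually_liouvilleSum_natCast_nonneg`
  (`LiouvilleOneSidedRH.lean`: `lim inf L(x)/√x ≤ 1/ζ(1/2) < 0`, Montgomery–Vaughan §15.1.1
  Exercise 8 (b) — Landau's theorem at the pole `s = ½` of `ζ(2s)/(sζ(s))`; the second of the four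
  conjuncts of `Haselgrove1958_signChanges`, the elementary half of "`L(x)` changes sign infinitely
  often"), used directly and not restated in this file. So the disjunct "eventually `L(n) ≥ 0`" is
  void and the hypothesis is **equivalent to the eventual Pólya inequality** "`L(n) ≤ 0` for all
  large `n`", whose refutation (`L(n) > 0` for infinitely many `n`) is Haselgrove's numerical
  application of Ingham's kernel method ("selecting `m = 1000` and `y = 831.847` produces
  `A*_m(y) ≈ .00495` … This computation employed the first 649 zeros", BFM §1, p. 1683) and is not
  reproduced here: `not_liouvilleSumEventuallyOneSigned_of_frequently_pos` isolates exactly that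
  input (the first conjunct of `Haselgrove1958_signChanges`,
  `not_liouvilleSumEventuallyOneSigned_of_haselgrove_pos`).
* `simpleZeros_of_liouvilleSumEventuallyOneSigned` — "It is also known that the zeros of the zeta
  function are all simple if `L(n)` is eventually of constant sign" (BFM §1, p. 1681; Ingham 1942,
  p. 1682), from the tree's
  `Literature.NumberTheory.LFunctions.simpleZeros_of_liouvilleSum_eventually_nonpos`
  (`LiouvilleOneSidedZeros.lean`: Titchmarsh's argument for Thm. 14.29 (A) transported to `L`) and
  the voidness of the other sign; with RH
  (`Literature.NumberTheory.LFunctions.riemannHypothesis_of_liouvilleSum_eventually_nonpos`, the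
  analytic route of `Polya1919_criterion_holds`) this is
  `riemannHypothesis_and_simpleZeros_of_liouvilleSumEventuallyOneSigned` — the first two of the
  three conclusions of the named fact `Ingham1942_liouville` (the third, infinitely many `ℤ`-linear
  dependencies among the ordinates, is Ingham's theorem proper and is not proved here).

## References

* [BorweinFergusonMossinghoff2008] P. Borwein, R. Ferguson, M. J. Mossinghoff, *Sign changes in
  sums of the Liouville function*, Math. Comp. 77 (2008), 1681–1694 — §1, pp. 1681–1683 (read).
* [MontgomeryVaughan2007] H. L. Montgomery, R. C. Vaughan, *Multiplicative Number Theory I*, CUP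
  2007 — §15.1 Lemma 15.1 (Landau); §15.1.1 Exercise 8 (b) (`lim inf L(x)/x^{1/2} ≤ 1/ζ(1/2)`)
  (read; through `LiouvilleOneSidedRH.lean`).
* [Titchmarsh1986] E. C. Titchmarsh, *The Theory of the Riemann Zeta-Function*, 2nd ed. — §14.29
  (proof of Thm. 14.29 (A)) (through `LiouvilleOneSidedZeros.lean`).
* [HaselgroveMathematika1958] C. B. Haselgrove, *A disproof of a conjecture of Pólya*,
  Mathematika 5 (1958), 141–145 — p. 143.
* [MossinghoffTrudgian2012] M. J. Mossinghoff, T. S. Trudgian, *Between the problems of Pólya and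
  Turán*, J. Aust. Math. Soc. 93 (2012) — §1, p. 158 (Ingham's three conclusions).
-/

noncomputable section

open Filter

namespace Literature.Barriers.RiemannHypothesis

/-! ## `L(n) < 0` infinitely often: the disjunct "eventually `L(n) ≥ 0`" is void -/

/-- `L(n)` is **not** eventually `≥ 0` — `L(n) < 0` for arbitrarily large integers `n`, the second
`L`-conjunct of the named fact `Haselgrove1958_signChanges`, holds unconditionally (the tree's
`Literature.NumberTheory.LFunctions.frequently_liouvilleSum_natCast_neg` and
`Literature.NumberTheory.LFunctions.not_eventually_liouvilleSum_natCast_nonneg`: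
`lim inf L(x)/√x ≤ 1/ζ(1/2) < 0`, Landau's theorem at the pole `s = ½`). Hence "`L(n)` does not
change sign for sufficiently large `n`" (`LiouvilleSumEventuallyOneSigned`) is **equivalent to the
eventual Pólya inequality** "`L(n) ≤ 0` for all large `n`" — the statement Haselgrove refuted in
1958 (`L(n) > 0` for infinitely many `n`; BFM 2008, §1, p. 1683). In particular the Prop
`LiouvilleSumEventuallyOneSigned` is a hypothesis, not a result, and has no `_holds`.
[cite: BorweinFergusonMossinghoff2008, §1 (pp. 1681, 1683)] [cite: MontgomeryVaughan2007, §15.1.1 Exercise 8 (b)] -/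
theorem liouvilleSumEventuallyOneSigned_iff_eventually_nonpos :
    (∃ N : ℕ, (∀ n : ℕ, N ≤ n → Literature.NumberTheory.LFunctions.liouvilleSum n ≤ 0) ∨ (∀ n : ℕ, N ≤ n → 0 ≤ Literature.NumberTheory.LFunctions.liouvilleSum n)) ↔
      ∃ N : ℕ, ∀ n : ℕ, N ≤ n → Literature.NumberTheory.LFunctions.liouvilleSum n ≤ 0 := by
  constructor
  · rintro ⟨N, hN | hN⟩
    · exact ⟨N, hN⟩
    · exact (Literature.NumberTheory.LFunctions.not_eventually_liouvilleSum_natCast_nonneg ⟨N, hN⟩).elim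
  · rintro ⟨N, hN⟩
    exact ⟨N, Or.inl hN⟩

/-- What remains of Haselgrove's theorem to refute the hypothesis: **if `L(n) > 0` for arbitrarily
large `n`** (Haselgrove 1958: "selecting `m = 1000` and `y = 831.847` produces `A*_m(y) ≈ .00495` …
it follows that `L(n) > 0` for infinitely many integers `n`", BFM 2008, §1, p. 1683 — the first
conjunct of `Haselgrove1958_signChanges`), then `¬ LiouvilleSumEventuallyOneSigned`.
[cite: BorweinFergusonMossinghoff2008, §1 (p. 1683)] [cite: HaselgroveMathematika1958, p. 143] -/
theorem not_liouvilleSumEventuallyOneSigned_of_frequently_pos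
    (h : ∃ᶠ n : ℕ in atTop, 0 < Literature.NumberTheory.LFunctions.liouvilleSum n) :
    ¬ ∃ N : ℕ, (∀ n : ℕ, N ≤ n → Literature.NumberTheory.LFunctions.liouvilleSum n ≤ 0) ∨ (∀ n : ℕ, N ≤ n → 0 ≤ Literature.NumberTheory.LFunctions.liouvilleSum n) := by
  rw [liouvilleSumEventuallyOneSigned_iff_eventually_nonpos]
  rintro ⟨N, hN⟩
  obtain ⟨n, hn, hNn⟩ := (h.and_eventually (eventually_ge_atTop N)).exists
  exact absurd (hN n hNn) (not_le.2 hn)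

/-- The first conjunct of the vendored `Haselgrove1958_signChanges` therefore already denies the
hypothesis (compare the barrier's `not_eventuallyOneSigned_of_haselgrove`, which uses both
`L`-conjuncts). [cite: HaselgroveMathematika1958, p. 143] -/
theorem not_liouvilleSumEventuallyOneSigned_of_haselgrove_pos (h : Haselgrove1958_signChanges) :
    ¬ ∃ N : ℕ, (∀ n : ℕ, N ≤ n → Literature.NumberTheory.LFunctions.liouvilleSum n ≤ 0) ∨ (∀ n : ℕ, N ≤ n → 0 ≤ Literature.NumberTheory.LFunctions.liouvilleSum n) :=
  not_liouvilleSumEventuallyOneSigned_of_frequently_pos h.1.1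

/-! ## Under the hypothesis: RH and simple zeros (Pólya 1919, Ingham 1942) -/

/-- **Simplicity of the zeros** ("It is also known that the zeros of the zeta function are all
simple if `L(n)` is eventually of constant sign", BFM 2008, §1, p. 1681; Ingham 1942, p. 1682): under
`LiouvilleSumEventuallyOneSigned` every non-trivial zero of `ζ` is simple
(`Literature.NumberTheory.LFunctions.SimpleZerosConjecture`). The case "eventually `L(n) ≤ 0`" is the
tree's `Literature.NumberTheory.LFunctions.simpleZeros_of_liouvilleSum_eventually_nonpos`
(`LiouvilleOneSidedZeros.lean`, `L(x) = L(⌊x⌋)`); the case "eventually `L(n) ≥ 0`" is void.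
[cite: BorweinFergusonMossinghoff2008, §1 (pp. 1681–1682)] [cite: Titchmarsh1986, §14.29 (proof of Thm 14.29 (A))] -/
theorem simpleZeros_of_liouvilleSumEventuallyOneSigned
    (h : ∃ N : ℕ, (∀ n : ℕ, N ≤ n → Literature.NumberTheory.LFunctions.liouvilleSum n ≤ 0) ∨ (∀ n : ℕ, N ≤ n → 0 ≤ Literature.NumberTheory.LFunctions.liouvilleSum n)) :
    Literature.NumberTheory.LFunctions.SimpleZerosConjecture := by
  rw [liouvilleSumEventuallyOneSigned_iff_eventually_nonpos] at h
  obtain ⟨N, hN⟩ := h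
  refine Literature.NumberTheory.LFunctions.simpleZeros_of_liouvilleSum_eventually_nonpos
    (x₁ := (N : ℝ)) fun x hx ↦ ?_
  rw [liouvilleSum_eq_floor]
  exact hN _ (Nat.le_floor hx)

/-- The first two conclusions of **Ingham 1942** as vendored in `Ingham1942_liouville` ("if `L(n)`
is eventually of constant sign, then not only would the Riemann hypothesis follow, but also the
zeros of `ζ(s)` would all be simple", Mossinghoff–Trudgian 2012, §1), proved: RH by the analytic
route of Pólya's criterion (the tree's
`Literature.NumberTheory.LFunctions.riemannHypothesis_of_liouvilleSum_eventually_nonpos`; the named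
fact `Polya1919_criterion` is discharged as `Polya1919_criterion_holds` in
`LiouvilleSignConjecturesProofs.lean`) and simplicity by
`simpleZeros_of_liouvilleSumEventuallyOneSigned`. The third conclusion (infinitely many `ℤ`-linear
dependencies among the ordinates) is not proved here. [cite: BorweinFergusonMossinghoff2008, §1 (pp. 1681–1682)]
[cite: MossinghoffTrudgian2012, §1 (p. 158)] -/
theorem riemannHypothesis_and_simpleZeros_of_liouvilleSumEventuallyOneSigned
    (h : ∃ N : ℕ, (∀ n : ℕ, N ≤ n → Literature.NumberTheory.LFunctions.liouvilleSum n ≤ 0) ∨ (∀ n : ℕ, N ≤ n → 0 ≤ Literature.NumberTheory.LFunctions.liouvilleSum n)) :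
    RiemannHypothesis ∧ Literature.NumberTheory.LFunctions.SimpleZerosConjecture := by
  refine ⟨?_, simpleZeros_of_liouvilleSumEventuallyOneSigned h⟩
  rw [liouvilleSumEventuallyOneSigned_iff_eventually_nonpos] at h
  obtain ⟨N, hN⟩ := h
  refine Literature.NumberTheory.LFunctions.riemannHypothesis_of_liouvilleSum_eventually_nonpos
    (x₁ := (N : ℝ)) fun x hx ↦ ?_
  rw [liouvilleSum_eq_floor]
  exact hN _ (Nat.le_floor hx)

end Literature.Barriers.RiemannHypothesis
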